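/-
Copyright (c) 2026 the pub-hodgecm-mathlib formalisation cell (harness21).  Prover seat hodgecm-mathlib-K2E3-p12 (g4), Track B «K2-LIT» ∕ h413
(`stmt-HodgeConjecture-24833`), line `K2_E3_EllipticInputs`, unit U12-d, §L (Φ′-a2): `Ad`-EQUIVARIANCE OF THE TRANSPORT `Φ : 𝔲(1,1) ≃ 𝔤𝔩₂(F)` — every `g ∈ GL₂(F)`
with `det g` a norm is `Ad(u)` for a unitary `u`: `Φ(uXu⁻¹) = g·Φ(X)·g⁻¹`.  2026-09-04.
-/
import Summits.HodgeConjecture.HodgeConjecture.Theorems.K2E3U11LieTransport    -- (Φ′-a) (this seat): `Φ`, coordinates, `exists_coords`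
import HarnessLib

/-!
# K2_E3 road (h413), §L — (Φ′-a2): `Φ ∘ Ad(u_g) = Ad(g) ∘ Φ` for `det g ∈ Nm(Eˣ)` — the unitary group `U(σ, J₀)` acts on `𝔤𝔩₂(F)` through `G⁺ = det⁻¹(Nm Eˣ)`

Cell `pub/hodgecm-mathlib` (D-0151), Track B, seat K2E3-p12 (g4), §L line lead (MEMO v3 76bc1f2b (T3)).  `--supports stmt-HodgeConjecture-24833 --as helper`;
THEOREMS ONLY (no definition ∕ instance ∕ notation ∕ named fact ∕ `sorry`); never imports `Cruxes/…/Lines`.  COUNT-NEUTRAL.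

MEMO v3 (T3): with `D = diag(λ, 1)`, `D·U(σ,J₀)·D⁻¹ = {β·g : β ∈ Eˣ, g ∈ GL₂(F), Nm β · det g = 1}`.  This file proves the half the transport of (L-B_U)′ needs:
* §1 `exists_diagLam` (`D` and `D⁻¹ = diag(λ⁻¹, 1)` as units), **`lieTransport_map_eq_conj_add`**: `(ΦX).map ι = D·X·D⁻¹ + (1 − λ)·ι(im X₀₀)·1` (the coordinate-free
  description of `Φ`), `trace_units_conj` (`tr(uXu⁻¹) = tr X`).
* §2 **`exists_unitary_lieTransport_conj_eq`**: for `g ∈ GL₂(F)` and `e ∈ E` with `ι(det g)·e·σ(e) = 1` (i.e. `det g ∈ Nm(Eˣ)`), the matrix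
  `u = D⁻¹·(e·g)·D = e·!![g₀₀, λ⁻¹g₀₁; λg₁₀, g₁₁]` lies in `U(σ, J₀)` and **`Φ(u X u⁻¹) = g·Φ(X)·g⁻¹`** for every `X ∈ 𝔲(σ,J₀)`.  Consequently a functional on
  `C_c^∞(𝔲)` invariant under `Ad(U(σ,J₀))` transports to a functional on `C_c^∞(𝔤𝔩₂(F))` invariant under `Ad(g)` for all `g` with `det g ∈ Nm(Eˣ)` — the group
  `G⁺` of ★ `K2E3GL2NilpotentOrbitsDetClass.nilpotentStructure_of_detSubgroup` (`D = Nm(Eˣ)`).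
[PlatonovRapinchuk1994, §2.3 (`SU(1,1) ≅ SL₂`, forms of `SL₂`)]; [Rogawski1990, §8.1 p. 112].

References: [PlatonovRapinchuk1994] V. Platonov, A. Rapinchuk, *Algebraic Groups and Number Theory* (1994), §2.3 · [Rogawski1990] J. D. Rogawski, *Automorphic
Representations of Unitary Groups in Three Variables* (1990), §8.1.
-/

set_option autoImplicit false
set_option linter.dupNamespace false   -- `Summit.HodgeConjecture.HodgeConjecture.…` (D-0017 nested layout; lakefile exemption for Summits)

noncomputable section

open scoped Matrix MatrixGroups
open Literature.NumberTheory.Automorphic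
open Summit.HodgeConjecture.HodgeConjecture.Cruxes.H413.K2E3LieUnitary (lieOfForm mem_lieOfForm_iff conj_mem_lieOfForm)
open Summit.HodgeConjecture.HodgeConjecture.Cruxes.H413.K2E3U11LieTransport

namespace Summit.HodgeConjecture.HodgeConjecture.Cruxes.H413.K2E3U11LieTransportEquivariance

variable {F E : Type*} [Field F] [Field E] (σ : E →+* E) (ι : F →+* E) (lam : E) (ρ : E → F × F)
  (hρ1 : ∀ z, ι (ρ z).1 + lam * ι (ρ z).2 = z) (hσι : ∀ r, σ (ι r) = ι r) (hσl : σ lam = -lam) (h2 : (2 : E) ≠ 0) (d : F) (hd : lam * lam = ι d)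
  (hl0 : lam ≠ 0)
  (Φ : ↥(lieOfForm σ !![(0 : E), 1; 1, 0]) → Matrix (Fin 2) (Fin 2) F)
  (hΦ : ∀ X : ↥(lieOfForm σ !![(0 : E), 1; 1, 0]),
    Φ X = !![(ρ (X.1 0 0)).1 + (ρ (X.1 0 0)).2, d * (ρ (X.1 0 1)).2; (ρ (X.1 1 0)).2, (ρ (X.1 0 0)).2 - (ρ (X.1 0 0)).1])

/-! ## §1  `Φ` as `Ad(diag(λ,1))` plus a central shift -/

include hl0 in
/-- `D = diag(λ, 1) ∈ GL₂(E)` with `D⁻¹ = diag(λ⁻¹, 1)`. [folklore] -/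
theorem exists_diagLam : ∃ D : GL (Fin 2) E, (D : Matrix (Fin 2) (Fin 2) E) = !![lam, 0; 0, 1] ∧ ((D⁻¹ : GL (Fin 2) E) : Matrix (Fin 2) (Fin 2) E) = !![lam⁻¹, 0; 0, 1] := by
  have hdet : (!![lam, 0; 0, 1] : Matrix (Fin 2) (Fin 2) E).det ≠ 0 := by rw [Matrix.det_fin_two]; simp [hl0]
  refine ⟨Matrix.GeneralLinearGroup.mkOfDetNeZero _ hdet, rfl, Units.inv_eq_of_mul_eq_one_right ?_⟩
  show (!![lam, 0; 0, 1] : Matrix (Fin 2) (Fin 2) E) * !![lam⁻¹, 0; 0, 1] = 1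
  rw [Matrix.mul_fin_two, Matrix.one_fin_two]
  ext i j
  fin_cases i <;> fin_cases j <;> simp [hl0]

omit [Field F] in
/-- Conjugation by `diag(λ,1)`: `D·X·D⁻¹ = !![X₀₀, λX₀₁; λ⁻¹X₁₀, X₁₁]`. [folklore] -/
theorem diag_conj_eq (D : GL (Fin 2) E) (hD : (D : Matrix (Fin 2) (Fin 2) E) = !![lam, 0; 0, 1])
    (hDi : ((D⁻¹ : GL (Fin 2) E) : Matrix (Fin 2) (Fin 2) E) = !![lam⁻¹, 0; 0, 1]) (hl0 : lam ≠ 0) (X : Matrix (Fin 2) (Fin 2) E) :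
    (D : Matrix (Fin 2) (Fin 2) E) * X * ((D⁻¹ : GL (Fin 2) E) : Matrix (Fin 2) (Fin 2) E) = !![X 0 0, lam * X 0 1; lam⁻¹ * X 1 0, X 1 1] := by
  have hμ : lam * lam⁻¹ = 1 := mul_inv_cancel₀ hl0
  rw [hD, hDi, Matrix.eta_fin_two X, Matrix.mul_fin_two, Matrix.mul_fin_two]
  ext i j
  fin_cases i <;> fin_cases j
  · simp; linear_combination (X 0 0) * hμ
  · simp
  · simp; ring
  · simp

omit [Field F] in
/-- `tr(u X u⁻¹) = tr X`. [folklore] -/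
theorem trace_units_conj (u : GL (Fin 2) E) (X : Matrix (Fin 2) (Fin 2) E) :
    Matrix.trace ((u : Matrix (Fin 2) (Fin 2) E) * X * ((u⁻¹ : GL (Fin 2) E) : Matrix (Fin 2) (Fin 2) E)) = Matrix.trace X := by
  rw [Matrix.trace_mul_cycle, Units.inv_mul, Matrix.one_mul]

include hρ1 hσι hσl h2 hd hΦ in
/-- **`Φ` is `Ad(D)` plus a central shift**: `(ΦX).map ι = D·X·D⁻¹ + (1 − λ)·ι(im X₀₀)·1` for `X ∈ 𝔲(σ, J₀)` (MEMO v3 (T2): `Φ(X_s + zλ·1) = D X_s D⁻¹ + z·1`).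
[cite: PlatonovRapinchuk1994, §2.3] -/
theorem lieTransport_map_eq_conj_add (D : GL (Fin 2) E) (hD : (D : Matrix (Fin 2) (Fin 2) E) = !![lam, 0; 0, 1])
    (hDi : ((D⁻¹ : GL (Fin 2) E) : Matrix (Fin 2) (Fin 2) E) = !![lam⁻¹, 0; 0, 1]) (hl0 : lam ≠ 0) (X : ↥(lieOfForm σ !![(0 : E), 1; 1, 0])) :
    (Φ X).map ι = (D : Matrix (Fin 2) (Fin 2) E) * X.1 * ((D⁻¹ : GL (Fin 2) E) : Matrix (Fin 2) (Fin 2) E) +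
      ((1 - lam) * ι (ρ (X.1 0 0)).2) • (1 : Matrix (Fin 2) (Fin 2) E) := by
  obtain ⟨x₁, x₂, β, γ, hx₂, hXe, hΦX⟩ := exists_coords σ ι lam ρ hρ1 hσι hσl h2 d Φ hΦ X
  have hμ : lam⁻¹ * lam = 1 := inv_mul_cancel₀ hl0
  rw [hx₂, diag_conj_eq lam D hD hDi hl0, hXe, hΦX]
  ext i j
  fin_cases i <;> fin_cases j
  · simp; ring
  · simp; linear_combination (-(ι β)) * hd
  · simp; linear_combination (-(ι γ)) * hμ
  · simp; ring

/-! ## §2  `Ad`-equivariance: `Φ(u X u⁻¹) = g·Φ(X)·g⁻¹` for `det g ∈ Nm(Eˣ)` -/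

include hρ1 hσι hσl h2 hd hl0 hΦ in
/-- **EQUIVARIANCE ∕ `G⁺`-SURJECTIVITY OF THE TRANSPORT.**  For `g ∈ GL₂(F)` and `e ∈ E` with `ι(det g)·(e·σe) = 1` — i.e. `det g` is a norm from `E` — the matrix
`u = e·!![g₀₀, λ⁻¹g₀₁; λg₁₀, g₁₁] = D⁻¹(e·g)D` lies in the unitary group `U(σ, J₀)` and `Φ(u X u⁻¹) = g·Φ(X)·g⁻¹` for every `X ∈ 𝔲(σ, J₀)`.  So an `Ad(U(σ,J₀))`-
invariant functional on `𝔲` transports to an `Ad(G⁺)`-invariant functional on `𝔤𝔩₂(F)`, `G⁺ = det⁻¹(Nm Eˣ)` (MEMO v3 (T3)–(T4)).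
[cite: PlatonovRapinchuk1994, §2.3] [cite: Rogawski1990, §8.1 p. 112] -/
theorem exists_unitary_lieTransport_conj_eq (g : GL (Fin 2) F) (e : E) (he : ι ((g : Matrix (Fin 2) (Fin 2) F).det) * (e * σ e) = 1) :
    ∃ u ∈ unitaryGroupOfForm σ !![(0 : E), 1; 1, 0], ∀ X Y : ↥(lieOfForm σ !![(0 : E), 1; 1, 0]),
      Y.1 = (u : Matrix (Fin 2) (Fin 2) E) * X.1 * ((u⁻¹ : GL (Fin 2) E) : Matrix (Fin 2) (Fin 2) E) →
        Φ Y = (g : Matrix (Fin 2) (Fin 2) F) * Φ X * ((g⁻¹ : GL (Fin 2) F) : Matrix (Fin 2) (Fin 2) F) := by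
  obtain ⟨D, hD, hDi⟩ := exists_diagLam lam hl0
  -- scalars
  have hdetg : ι ((g : Matrix (Fin 2) (Fin 2) F).det) ≠ 0 := by
    rw [map_ne_zero_iff ι ι.injective]; exact Matrix.GeneralLinearGroup.det_ne_zero g
  have he0 : e ≠ 0 := by rintro rfl; rw [zero_mul, mul_zero] at he; exact zero_ne_one he
  have hσe : σ e * e = (ι ((g : Matrix (Fin 2) (Fin 2) F).det))⁻¹ := eq_inv_of_mul_eq_one_left (by linear_combination he)
  have hii : (ι ((g : Matrix (Fin 2) (Fin 2) F).det))⁻¹ * ι ((g : Matrix (Fin 2) (Fin 2) F).det) = 1 := inv_mul_cancel₀ hdetg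
  -- `g` and `g⁻¹` over `E`
  set gE : Matrix (Fin 2) (Fin 2) E := (g : Matrix (Fin 2) (Fin 2) F).map ι with hgE
  set gEi : Matrix (Fin 2) (Fin 2) E := ((g⁻¹ : GL (Fin 2) F) : Matrix (Fin 2) (Fin 2) F).map ι with hgEi
  have hgg : gE * gEi = 1 := by
    rw [hgE, hgEi, ← Matrix.map_mul, Units.mul_inv, Matrix.map_one ι (map_zero ι) (map_one ι)]
  have hgg' : gEi * gE = 1 := by
    rw [hgE, hgEi, ← Matrix.map_mul, Units.inv_mul, Matrix.map_one ι (map_zero ι) (map_one ι)]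
  -- the unitary `u = D⁻¹ (e • gE) D` and its inverse, written out
  set uM : Matrix (Fin 2) (Fin 2) E := !![e * gE 0 0, e * lam⁻¹ * gE 0 1; e * lam * gE 1 0, e * gE 1 1] with huM
  set uMi : Matrix (Fin 2) (Fin 2) E := !![e⁻¹ * gEi 0 0, e⁻¹ * lam⁻¹ * gEi 0 1; e⁻¹ * lam * gEi 1 0, e⁻¹ * gEi 1 1] with huMi
  have hL : (D : Matrix (Fin 2) (Fin 2) E) * uM = e • (gE * (D : Matrix (Fin 2) (Fin 2) E)) := by
    rw [hD, huM, Matrix.mul_fin_two, Matrix.eta_fin_two gE, Matrix.mul_fin_two]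
    have hμ : lam * lam⁻¹ = 1 := mul_inv_cancel₀ hl0
    ext i j
    fin_cases i <;> fin_cases j
    · simp; ring
    · simp; linear_combination (e * gE 0 1) * hμ
    · simp; ring
    · simp
  have hR : uMi * ((D⁻¹ : GL (Fin 2) E) : Matrix (Fin 2) (Fin 2) E) = e⁻¹ • (((D⁻¹ : GL (Fin 2) E) : Matrix (Fin 2) (Fin 2) E) * gEi) := by
    rw [hDi, huMi, Matrix.mul_fin_two, Matrix.eta_fin_two gEi, Matrix.mul_fin_two]
    have hμ : lam * lam⁻¹ = 1 := mul_inv_cancel₀ hl0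
    ext i j
    fin_cases i <;> fin_cases j
    · simp; ring
    · simp; ring
    · simp; linear_combination (e⁻¹ * gEi 1 0) * hμ
    · simp
  have hDD : (D : Matrix (Fin 2) (Fin 2) E) * ((D⁻¹ : GL (Fin 2) E) : Matrix (Fin 2) (Fin 2) E) = 1 := Units.mul_inv _
  have hDD' : ((D⁻¹ : GL (Fin 2) E) : Matrix (Fin 2) (Fin 2) E) * (D : Matrix (Fin 2) (Fin 2) E) = 1 := Units.inv_mul _
  -- `uM = D⁻¹ (e • gE D)`, `uMi = (e⁻¹ • D⁻¹ gEi) D`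
  have e1 : uM = ((D⁻¹ : GL (Fin 2) E) : Matrix (Fin 2) (Fin 2) E) * (e • (gE * (D : Matrix (Fin 2) (Fin 2) E))) := by
    rw [← hL, Units.inv_mul_cancel_left]
  have e2 : uMi = (e⁻¹ • (((D⁻¹ : GL (Fin 2) E) : Matrix (Fin 2) (Fin 2) E) * gEi)) * (D : Matrix (Fin 2) (Fin 2) E) := by
    rw [← hR, Units.inv_mul_cancel_right]
  have huu : uM * uMi = 1 := by
    rw [e1, e2]
    simp only [Matrix.mul_smul, Matrix.smul_mul, smul_smul, inv_mul_cancel₀ he0, one_smul, Matrix.mul_assoc, Units.mul_inv_cancel_left]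
    rw [← Matrix.mul_assoc gE, hgg, Matrix.one_mul, Units.inv_mul]
  have hdetu : uM.det ≠ 0 := by
    intro h
    have := congrArg Matrix.det huu
    rw [Matrix.det_mul, h, zero_mul, Matrix.det_one] at this
    exact zero_ne_one this
  obtain ⟨u, hu⟩ : ∃ u : GL (Fin 2) E, (u : Matrix (Fin 2) (Fin 2) E) = uM := ⟨Matrix.GeneralLinearGroup.mkOfDetNeZero _ hdetu, rfl⟩
  have hui : ((u⁻¹ : GL (Fin 2) E) : Matrix (Fin 2) (Fin 2) E) = uMi := Units.inv_eq_of_mul_eq_one_right (by rw [hu, huu])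
  -- `u` is unitary for `J₀`
  have hdetE : gE 0 0 * gE 1 1 - gE 0 1 * gE 1 0 = ι ((g : Matrix (Fin 2) (Fin 2) F).det) := by
    rw [Matrix.det_fin_two, hgE]; simp only [Matrix.map_apply, map_sub, map_mul]
  have hσg : ∀ i j, σ (gE i j) = gE i j := fun i j => by rw [hgE, Matrix.map_apply, hσι]
  have hunit : u ∈ unitaryGroupOfForm σ !![(0 : E), 1; 1, 0] := by
    rw [mem_unitaryGroupOfForm_iff, hu, huM]
    have hli : σ lam⁻¹ = -lam⁻¹ := by rw [map_inv₀, hσl, inv_neg]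
    have hμ : lam * lam⁻¹ = 1 := mul_inv_cancel₀ hl0
    ext i j
    fin_cases i <;> fin_cases j <;>
      (simp only [Matrix.mul_apply, Fin.sum_univ_two, Matrix.transpose_apply, Matrix.map_apply]; simp [map_mul, hσg, hσl, hli])
    all_goals first | ring1 | linear_combination (ι ((g : Matrix (Fin 2) (Fin 2) F).det)) * hσe + hii + (σ e * e) * hdetE - (σ e * e * gE 1 0 * gE 0 1) * hμ
  refine ⟨u, hunit, fun X Y hY => ?_⟩
  -- `Φ Y` versus `g Φ X g⁻¹`, through `map ι`
  apply Matrix.map_injective ι.injective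
  have htr : Matrix.trace Y.1 = Matrix.trace X.1 := by rw [hY, trace_units_conj]
  have hc : (ρ (Y.1 0 0)).2 = (ρ (X.1 0 0)).2 := im_eq_of_trace_eq σ ι lam ρ hρ1 hσι hσl h2 hl0 X.2 Y.2 htr
  have hDY : (D : Matrix (Fin 2) (Fin 2) E) * Y.1 * ((D⁻¹ : GL (Fin 2) E) : Matrix (Fin 2) (Fin 2) E) =
      gE * ((D : Matrix (Fin 2) (Fin 2) E) * X.1 * ((D⁻¹ : GL (Fin 2) E) : Matrix (Fin 2) (Fin 2) E)) * gEi := by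
    rw [hY, hu, hui, e1, e2]
    simp only [Matrix.mul_assoc, Matrix.mul_smul, Matrix.smul_mul, smul_smul, inv_mul_cancel₀ he0, one_smul, Units.mul_inv_cancel_left,
      Units.mul_inv, Matrix.mul_one]
  show (Φ Y).map ι = ((g : Matrix (Fin 2) (Fin 2) F) * Φ X * ((g⁻¹ : GL (Fin 2) F) : Matrix (Fin 2) (Fin 2) F)).map ι
  rw [Matrix.map_mul, Matrix.map_mul, lieTransport_map_eq_conj_add σ ι lam ρ hρ1 hσι hσl h2 d hd Φ hΦ D hD hDi hl0 Y,
    lieTransport_map_eq_conj_add σ ι lam ρ hρ1 hσι hσl h2 d hd Φ hΦ D hD hDi hl0 X, hc, hDY, ← hgE, ← hgEi, Matrix.mul_add, Matrix.add_mul,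
    Matrix.mul_smul, Matrix.smul_mul, Matrix.mul_one, hgg]

end Summit.HodgeConjecture.HodgeConjecture.Cruxes.H413.K2E3U11LieTransportEquivariance
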